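import Literature.MathematicalPhysics.QuantumFieldTheory.QuasiLocalGaugePerturbationWilson
import Summits.QuantumFields.QCD.Theorems.NestedDissectionSeaRobustYangMillsRGStubSU3SignSet
import HarnessLib

/-!
# Toolkit for `stub_formatBallClustering_false` (line `birth`, crux `RobustYangMillsRG`,
# item stmt-QuantumFields-17812), part IV: the Wilson action under one-link modifications;
# the format clauses of the witness

* the ONE-LINK VARIATION BOUND of the Wilson action (`abs_wilsonAction_sub_le`, registered in its
  `SU(3)`, `d = 4` form as `stub_formatBallClustering_oneLinkVariation`): `|S(V') - S(V)| ≤ 3 d² · 4N`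
  when `V, V'` differ on one link — only the `≤ 3 d²` plaquettes whose support polymer contains the
  link's base point change (tree `plaquetteCost_congr`, `card_filter_mem_plaquetteSupport_le`), each
  cost lying in `[-2N, 2N]`; hence the Gibbs factor `e^{-β S_W} ∈ (0, 1]` (measurable) drops by at
  most `e^{-576 β}` under a one-link modification (finite energy);
* the format clauses of the witness `A = wilson` (coercivity with `cA = 1` and equality; the range
  clause: activity-carrying polymers are plaquette supports `{x, x + eᵢ, x + eⱼ}`) and of the signed
  rough functional `F(Z, V) = ∏_{y ∈ T} (φ(V(y,1)) if y ∈ Z else 1)` for an arbitrary site set `T`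
  (measurable, `F(∅) = 1`, `|F| ≤ 1`, exactly local, exactly multiplicative over separated regions).
-/

noncomputable section

namespace Summit.QuantumFields.QCD.Cruxes.RobustYangMillsRG.Birth

open scoped BigOperators Topology Manifold Classical MeasureTheory ProbabilityTheory Matrix InnerProductSpace ComplexConjugate ContinuousMap
open Filter Set Function TopologicalSpace MeasureTheory
open Literature.MathematicalPhysics.QuantumLattice Literature.MathematicalPhysics.AQFT
  Literature.MathematicalPhysics.QuantumFieldTheory
open Summit.QuantumFields.QCD.Theorems.RobustYangMillsRG.Negative (SU3)

namespace SignedFormat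

/-! ### The Wilson action: one-link variation, the Gibbs factor -/

section Wilson

variable {d L N : ℕ} [NeZero L] {G : Type*} [Group G]

/-- **One-link variation of the Wilson action.** If `V'` and `V` agree off one link `e₀`, then
`|S(V') - S(V)| ≤ 3 d² · 4N`: only plaquettes whose support polymer (block scale `1`) contains the
base point of `e₀` can change (`plaquetteCost_congr`), there are at most `3 d²` of them
(`card_filter_mem_plaquetteSupport_le`), and each cost lies in `[-2N, 2N]` for unitary `ρ`. [folklore] -/
theorem abs_wilsonAction_sub_le (ρ : G →* Matrix (Fin N) (Fin N) ℂ)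
    (hρu : ∀ g, ρ g ∈ Matrix.unitaryGroup (Fin N) ℂ) {V V' : GaugeConfig d L G} (e₀ : Edge d L)
    (h : ∀ e, e ≠ e₀ → V' e = V e) :
    |wilsonAction ρ V' - wilsonAction ρ V| ≤ (3 * d ^ 2 * 1 ^ d : ℕ) * (2 * (2 * N)) := by
  rw [wilsonAction_eq_sum_plaquetteCost, wilsonAction_eq_sum_plaquetteCost, ← Finset.sum_sub_distrib]
  set Pf := Finset.univ.filter fun p : Plaquette d L => e₀.1 ∈ plaquetteSupport 1 p with hPf
  have hzero : ∀ p ∈ (Finset.univ : Finset (Plaquette d L)), p ∉ Pf →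
      plaquetteCost ρ V' p - plaquetteCost ρ V p = 0 := by
    intro p _ hp
    have hp' : e₀.1 ∉ plaquetteSupport 1 p := fun h' => hp (Finset.mem_filter.2 ⟨Finset.mem_univ _, h'⟩)
    rw [sub_eq_zero]
    refine plaquetteCost_congr ρ (b := 1) fun e he => h e ?_
    rintro rfl
    rw [mem_polymerEdges_iff, blockCorner_one] at he
    exact hp' he
  rw [← Finset.sum_subset (Finset.subset_univ Pf) hzero]
  refine (Finset.abs_sum_le_sum_abs _ _).trans ?_
  refine (Finset.sum_le_sum fun p _ => (abs_sub _ _).trans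
    (add_le_add (abs_plaquetteCost_le_of_unitary ρ hρu V' p) (abs_plaquetteCost_le_of_unitary ρ hρu V p))).trans ?_
  rw [Finset.sum_const, nsmul_eq_mul, show (2 * N + 2 * N : ℝ) = 2 * (2 * N) by ring]
  refine mul_le_mul_of_nonneg_right ?_ (by positivity)
  exact_mod_cast card_filter_mem_plaquetteSupport_le (d := d) (L := L) Nat.one_pos e₀.1

variable {M : ℕ} [NeZero M]

/-- The Wilson action of the fundamental `SU(3)` theory is nonnegative (`Re tr u ≤ 3`). [folklore] -/
theorem wilsonAction_su3_nonneg (V : GaugeConfig 4 M SU3) : 0 ≤ wilsonAction (fundamentalRep (Fin 3)) V := by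
  unfold wilsonAction
  refine Finset.sum_nonneg fun p _ => sub_nonneg.2 ?_
  simp only [fundamentalRep_apply, Nat.cast_ofNat]
  exact (le_abs_self _).trans (abs_re_trace_su3_le _)

/-- For `SU(3)` in `d = 4`: right-multiplying one link changes the Wilson action by at most `576`. [folklore] -/
theorem wilsonAction_update_le (e₀ : Edge 4 M) (V : GaugeConfig 4 M SU3) (a : SU3) :
    wilsonAction (fundamentalRep (Fin 3)) (Function.update V e₀ (V e₀ * a)) ≤
      wilsonAction (fundamentalRep (Fin 3)) V + 576 := by
  have h := abs_wilsonAction_sub_le (d := 4) (L := M) (fundamentalRep (Fin 3)) fundamentalRep_mem_unitaryGroup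
    (V := V) (V' := Function.update V e₀ (V e₀ * a)) e₀ fun e he => Function.update_of_ne he _ V
  have h' := (abs_le.1 h).2
  norm_num at h'
  linarith

/-- The Gibbs factor `Ψ_β = exp(-β S_W)` is at most one for `β ≥ 0`. [folklore] -/
theorem gibbs_le_one {β : ℝ} (hβ : 0 ≤ β) (V : GaugeConfig 4 M SU3) :
    Real.exp (-(β * wilsonAction (fundamentalRep (Fin 3)) V)) ≤ 1 :=
  Real.exp_le_one_iff.2 (neg_nonpos.2 (mul_nonneg hβ (wilsonAction_su3_nonneg V)))

/-- The Gibbs factor is measurable. [folklore] -/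
theorem measurable_gibbs (β : ℝ) :
    Measurable fun V : GaugeConfig 4 M SU3 => Real.exp (-(β * wilsonAction (fundamentalRep (Fin 3)) V)) := by
  have h : Measurable (wilsonAction (d := 4) (L := M) (fundamentalRep (Fin 3)) : GaugeConfig 4 M SU3 → ℝ) := by
    rw [← QuasiLocalGaugePerturbation.total_wilson (fundamentalRep (Fin 3)) (continuous_fundamentalRep (Fin 3)) 1]
    exact QuasiLocalGaugePerturbation.measurable_total _
  exact Real.measurable_exp.comp (measurable_const.mul h).neg

/-- **Finite-energy bound**: modifying one link costs at most a factor `exp(-576 β)` in the Gibbs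
factor (`β ≥ 0`). [folklore] -/
theorem gibbs_update_ge {β : ℝ} (hβ : 0 ≤ β) (e₀ : Edge 4 M) (V : GaugeConfig 4 M SU3) (a : SU3) :
    Real.exp (-(β * 576)) * Real.exp (-(β * wilsonAction (fundamentalRep (Fin 3)) V)) ≤
      Real.exp (-(β * wilsonAction (fundamentalRep (Fin 3)) (Function.update V e₀ (V e₀ * a)))) := by
  rw [← Real.exp_add]
  refine Real.exp_le_exp.2 ?_
  have h := mul_le_mul_of_nonneg_left (wilsonAction_update_le e₀ V a) hβ
  linarith

/-- The Wilson action vanishes at the trivial configuration. [folklore] -/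
theorem wilsonAction_const_one :
    wilsonAction (fundamentalRep (Fin 3)) (fun _ : Edge 4 M => (1 : SU3)) = 0 := by
  unfold wilsonAction plaquetteHolonomy
  simp [Matrix.trace_one]

/-- Coercivity clause of the witness `A = wilson` (`cA = 1`, with equality). [folklore] -/
theorem wilson_coercive (V : GaugeConfig 4 M SU3) :
    1 * wilsonAction (fundamentalRep (Fin 3)) V ≤
      (QuasiLocalGaugePerturbation.wilson (fundamentalRep (Fin 3)) (continuous_fundamentalRep (Fin 3)) 1 :
          QuasiLocalGaugePerturbation 4 M SU3 1).total V -
        (QuasiLocalGaugePerturbation.wilson (fundamentalRep (Fin 3)) (continuous_fundamentalRep (Fin 3)) 1 :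
          QuasiLocalGaugePerturbation 4 M SU3 1).total fun _ => 1 := by
  simp only [QuasiLocalGaugePerturbation.total_wilson, wilsonAction_const_one]
  simp

omit [NeZero M] in
/-- In `ZMod M`, two elements of `{0, 1}` differ by an element of representative `≤ 1` in one of
the two orders. [folklore] -/
theorem val_sub_le_one_or {u u' : ZMod M} (hu : u = 0 ∨ u = 1) (hu' : u' = 0 ∨ u' = 1) :
    (u - u').val ≤ 1 ∨ (u' - u).val ≤ 1 := by
  have h1 : (1 : ZMod M).val ≤ 1 := by rw [ZMod.val_one_eq_one_mod]; exact Nat.mod_le 1 M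
  rcases hu with rfl | rfl <;> rcases hu' with rfl | rfl <;> simp [h1]

/-- **Range clause of the witness**: a polymer carrying Wilson activity is the support
`{x, x + eᵢ, x + eⱼ}` of a plaquette, whose points differ coordinatewise by `0` or `±1`. [folklore] -/
theorem wilson_range (X : Finset (Site 4 M))
    (hX : ∃ V, (QuasiLocalGaugePerturbation.wilson (fundamentalRep (Fin 3)) (continuous_fundamentalRep (Fin 3)) 1 :
      QuasiLocalGaugePerturbation 4 M SU3 1).act X V ≠ 0) :
    ∀ y ∈ X, ∀ y' ∈ X, ∀ i, (y i - y' i).val ≤ X.card ∨ (y' i - y i).val ≤ X.card := by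
  obtain ⟨V, hV⟩ := hX
  rw [QuasiLocalGaugePerturbation.wilson_act] at hV
  obtain ⟨p, hp, -⟩ := Finset.exists_ne_zero_of_sum_ne_zero hV
  have hpX : plaquetteSupport 1 p = X := (Finset.mem_filter.1 hp).2
  subst hpX
  have hcard : 1 ≤ (plaquetteSupport 1 p).card :=
    Finset.card_pos.2 ⟨_, blockCorner_mem_plaquetteSupport 1 p⟩
  -- every point of the support is `p.1 + u` with `u ∈ {0, 1}^4`
  have hpt : ∀ y ∈ plaquetteSupport 1 p, ∃ u : Site 4 M, (∀ k, u k = 0 ∨ u k = 1) ∧ y = p.1 + u := by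
    intro y hy
    simp only [plaquetteSupport, blockCorner_one, Finset.mem_insert, Finset.mem_singleton] at hy
    rcases hy with rfl | rfl | rfl
    · exact ⟨0, fun k => Or.inl rfl, (add_zero _).symm⟩
    · exact ⟨Pi.single p.2.1.1 1, fun k => by rw [Pi.single_apply]; split_ifs <;> simp, rfl⟩
    · exact ⟨Pi.single p.2.1.2 1, fun k => by rw [Pi.single_apply]; split_ifs <;> simp, rfl⟩
  intro y hy y' hy' i
  obtain ⟨u, hu, rfl⟩ := hpt y hy
  obtain ⟨u', hu', rfl⟩ := hpt y' hy'
  simp only [Pi.add_apply, add_sub_add_left_eq_sub]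
  exact (val_sub_le_one_or (hu i) (hu' i)).imp (fun h => h.trans hcard) fun h => h.trans hcard

end Wilson

/-! ### The witness rough functional `F(Z, V) = ∏_{y ∈ T} (φ(V(y,1)) if y ∈ Z else 1)` -/

section Witness

variable {M : ℕ} {G : Type*} (T : Finset (Site 4 M))

/-- Translation by the zero vector is the identity. [folklore] -/
theorem torusConfigShift_zero {d L : ℕ} [MeasurableSpace G] (U : GaugeConfig d L G) :
    torusConfigShift (0 : Site d L) U = U := by
  funext e
  rw [torusConfigShift_apply, sub_zero]

/-- `F(Z, ·)` is measurable. [folklore] -/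
theorem measurable_signF [MeasurableSpace G] {φ : G → ℝ} (hφ : Measurable φ) (Z : Finset (Site 4 M)) :
    Measurable fun V : GaugeConfig 4 M G => ∏ y ∈ T, (if y ∈ Z then φ (V (y, 1)) else 1) := by
  refine Finset.measurable_prod _ fun y _ => ?_
  by_cases h : y ∈ Z
  · simp only [h, if_true]; exact hφ.comp (measurable_pi_apply _)
  · simp only [h, if_false]; exact measurable_const

/-- `F(∅, ·) = 1`. [folklore] -/
theorem signF_empty (φ : G → ℝ) (V : GaugeConfig 4 M G) :
    ∏ y ∈ T, (if y ∈ (∅ : Finset (Site 4 M)) then φ (V (y, 1)) else 1) = 1 := by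
  simp

/-- `|F(Z, V)| ≤ 1`. [folklore] -/
theorem abs_signF_le_one {φ : G → ℝ} (hφ1 : ∀ u, |φ u| ≤ 1) (Z : Finset (Site 4 M)) (V : GaugeConfig 4 M G) :
    |∏ y ∈ T, (if y ∈ Z then φ (V (y, 1)) else 1)| ≤ 1 := by
  rw [Finset.abs_prod]
  refine Finset.prod_le_one (fun y _ => abs_nonneg _) fun y _ => ?_
  split_ifs
  · exact hφ1 _
  · simp

/-- Locality of `F`: `F(Z, ·)` only sees the links `(y, 1)`, `y ∈ Z` (which lie within distance `0`
of `Z`). [folklore] -/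
theorem signF_congr_local (φ : G → ℝ) {Z : Finset (Site 4 M)} {n : ℕ} {V V' : GaugeConfig 4 M G}
    (h : ∀ e : Edge 4 M, (∃ y ∈ Z, ∀ i, (e.1 i - y i).val ≤ n ∨ (y i - e.1 i).val ≤ n) → V e = V' e) :
    ∏ y ∈ T, (if y ∈ Z then φ (V (y, 1)) else 1) = ∏ y ∈ T, (if y ∈ Z then φ (V' (y, 1)) else 1) := by
  refine Finset.prod_congr rfl fun y _ => ?_
  by_cases hyZ : y ∈ Z
  · rw [if_pos hyZ, if_pos hyZ, h (y, 1) ⟨y, hyZ, fun i => Or.inl (by simp)⟩]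
  · rw [if_neg hyZ, if_neg hyZ]

/-- The separation hypothesis of the factorisation clause forces disjointness. [folklore] -/
theorem disjoint_of_separated {Z₁ Z₂ : Finset (Site 4 M)} {n : ℕ}
    (h : ∀ y ∈ Z₁, ∀ y' ∈ Z₂, ∃ i, n < (y i - y' i).val ∧ n < (y' i - y i).val) : Disjoint Z₁ Z₂ := by
  rw [Finset.disjoint_left]
  intro y h1 h2
  obtain ⟨i, hi, -⟩ := h y h1 y h2
  simp at hi

/-- Factorisation of `F` over separated regions (exact). [folklore] -/
theorem signF_union (φ : G → ℝ) {Z₁ Z₂ : Finset (Site 4 M)} {n : ℕ}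
    (h : ∀ y ∈ Z₁, ∀ y' ∈ Z₂, ∃ i, n < (y i - y' i).val ∧ n < (y' i - y i).val) (V : GaugeConfig 4 M G) :
    ∏ y ∈ T, (if y ∈ Z₁ ∪ Z₂ then φ (V (y, 1)) else 1) =
      (∏ y ∈ T, (if y ∈ Z₁ then φ (V (y, 1)) else 1)) * ∏ y ∈ T, (if y ∈ Z₂ then φ (V (y, 1)) else 1) := by
  have hd := disjoint_of_separated h
  rw [← Finset.prod_mul_distrib]
  refine Finset.prod_congr rfl fun y _ => ?_
  by_cases h1 : y ∈ Z₁
  · have h2 : y ∉ Z₂ := Finset.disjoint_left.1 hd h1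
    simp [h1, h2]
  · by_cases h2 : y ∈ Z₂
    · simp [h1, h2]
    · simp [h1, h2]

end Witness

end SignedFormat

/-! ### Registered sub-goal carried by this file -/

/-- **Registered sub-goal of Stub N3 carried by this support file** — the one-link variation bound
of the `SU(3)` Wilson action in `d = 4`: configurations that agree off one link have Wilson actions
within `576 = 48 · 12` of each other (`SignedFormat.abs_wilsonAction_sub_le`). [folklore] -/
theorem stub_formatBallClustering_oneLinkVariation : ∀ (M : ℕ) [NeZero M] (e₀ : Edge 4 M) (V V' : GaugeConfig 4 M ↥(Matrix.specialUnitaryGroup (Fin 3) ℂ)), (∀ e, e ≠ e₀ → V' e = V e) → |wilsonAction (fundamentalRep (Fin 3)) V' - wilsonAction (fundamentalRep (Fin 3)) V| ≤ 576 := by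
  intro M _ e₀ V V' h
  have h' := SignedFormat.abs_wilsonAction_sub_le (d := 4) (L := M) (fundamentalRep (Fin 3))
    fundamentalRep_mem_unitaryGroup e₀ h
  norm_num at h'
  exact h'

end Summit.QuantumFields.QCD.Cruxes.RobustYangMillsRG.Birth
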